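import Summits.BirchSwinnertonDyer.BirchSwinnertonDyer.Theorems.SylvesterTwoHeegnerIndexCMHalfLevelPackage
import Summits.BirchSwinnertonDyer.BirchSwinnertonDyer.Theorems.SylvesterTwoHeegnerIndexCMHalfFlipLevelPrime
import Summits.BirchSwinnertonDyer.BirchSwinnertonDyer.Theorems.SylvesterTwoHeegnerIndexCMHalfBottomClass
import Summits.BirchSwinnertonDyer.BirchSwinnertonDyer.Theorems.SylvesterTwoHeegnerIndexCMFlipBlockOne
import HarnessLib

/-!
# (S6) of leaf (L1) at `p ≡ 7 (mod 9)`, crux `UpperOffV0HSYPlus` (stmt-BirchSwinnertonDyer-19804): HALF BLOCK 1 —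
# the FLIP at one Kolyvagin prime for the HALVED class `c′_A(ℓ)`, against `δ Y′`

Skeleton of record VARIANT M (`Cruxes/UpperOffV0HSYPlus/Lines/coupled_variantM.lean` 406ca288e244d392), stub
`stub_layerL1Seven`; planner D507 (4), D510.  Twin of g24's #H-b `block1_of_level` for the HALF index set
`(𝒢₀⧸H) × H′`: for the global data of the rows' assembly (#H-a coherent `emb₀ ⊂ emb`, pinned `κ`, bottom transversal
`t`; #R-g coupled frame; #19's transport equation for HSY's `Y₁`), the bottom involution datum (`s ∈ H`, `s² = 1`, a
half `H′`, `s·y₁ = y₁`), THE TOWER FIXING AT `n = ℓ` (`φ ∈ Aut_K K[9pℓ]` restricting to `s`, `φ·y_ℓ = y_ℓ` — memo two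
§67.2 (W2-b), DISPLAYED), the half point `Y′` (`2 • Y′ = Y₁`, #S1) and ONE prime `ℓ` of the stub's Kolyvagin clause:
the class term `c′_A(ℓ) = c(ψ_A(Σ_{(q,h′)} ρ²_{t}(t • κ⁻¹ι_e(D_ℓ y_ℓ))))` is well-formed (`hA₁`, `hQN`, `hP₁` — #S4) and
**`c′_A(ℓ)` Selmer at `λ ∋ ℓ` ↔ `kummerClassOfPoint Y′ ∈ T_B(λ)`** (#S5 `flip_levelPrime_of_bottomSelmer`, (ES2) ↦
`hES2` via #20; the half bottom class = `δ Y′` by #S2 + #G, so `hsel₂` = «Kummer classes are Selmer»).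

Theorems only; no `def`, no `sorry`, no new `Prop`; `set_option maxHeartbeats 1600000 in` scoped to the one theorem.
HONEST LABEL: conditional on the DISPLAYED TOWER FIXING binders (cell lemma W2-b, unrefereed) + #19/#20/(★)-side
inputs of the callers; nothing asserted on 19804; no stub closed; X12.CMAtTwo NOT proved; BSD is not proved by any of
this.  `--supports stmt-BirchSwinnertonDyer-19804 --as helper`.
-/

set_option linter.dupNamespace false
set_option autoImplicit false

noncomputable section

open scoped Classical Pointwise

namespace Summit.BirchSwinnertonDyer.BirchSwinnertonDyer.Theorems.SylvesterTwoCMHalf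

open WeierstrassCurve Field NumberField IsDedekindDomain Finset
open Literature.NumberTheory.EllipticCurves Literature.NumberTheory.GaloisRepresentations
  Literature.NumberTheory.EllipticCurves.ModularForms
  Literature.NumberTheory.EllipticCurves.HuShuYin2019
  Literature.NumberTheory.EllipticCurves.KolyvaginCocycle
  Literature.NumberTheory.EllipticCurves.RingClassField
  Summit.BirchSwinnertonDyer.BirchSwinnertonDyer.Theorems.SylvesterTwoCMData
  Summit.BirchSwinnertonDyer.BirchSwinnertonDyer.Theorems.SylvesterTwoCMFlip
  Summit.BirchSwinnertonDyer.Rank1Residual.X11b Summit.BirchSwinnertonDyer.Rank1Residual.X11b.RingClassTower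

variable {K : Type} [Field K] [NumberField K]

set_option maxHeartbeats 1600000 in
/-- **HALF BLOCK 1 OF (L1) AT ONE KOLYVAGIN PRIME** (`p ≡ 7 (mod 9)` architecture): for the HALF class term at the
level `9pℓ` built from the tower-fixed CM point, `c′_A(ℓ)` is Selmer at `λ ∋ ℓ` iff `δ Y′ ∈ T_B(λ)`, `Y′` the half-trace
point (`2 • Y′ = Y₁`).  [cite: GrossLMS1991, Prop. 3.7, §4 (4.1)–(4.6), Prop. 6.2] [cite: McCallumLMS1991, Prop. 4.4]
[cite: HuShuYin2019, §1–§2, §4.1] [cite: Nekovar2007, Prop. 4.9] -/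
theorem half_block1_of_level {ω : K} (hω : ω ^ 2 + ω + 1 = 0) (h2 : Module.finrank ℚ K = 2)
    (ι : K →+* ℂ) (hES2 : Nekovar2007.cmPoint_frobeniusCongruence)
    (Dt : ModularParametrizationData (⟨0, 0, 1, 0, -1⟩ : WeierstrassCurve ℚ) 243)
    {p ℓ : ℕ} (hp : p.Prime) (hp3 : p % 3 = 1)
    (hKol : ℓ.Prime ∧ ¬ ℓ ∣ (cubeSumCurve (3 * (p : ℚ) ^ 2)).conductorNorm ℤ ∧
      ¬ ℓ ∣ (cubeSumCurve (p : ℚ)).conductorNorm ℤ ∧ ¬ ((ℓ : ℤ) ∣ NumberField.discr K) ∧ ℓ ≠ 2 ∧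
      (Ideal.span {(ℓ : 𝓞 K)}).IsPrime ∧
      FrobEqFrobInfty (cubeSumCurve (3 * (p : ℚ) ^ 2)) K 2 ℓ ∧ FrobEqFrobInfty (cubeSumCurve (p : ℚ)) K 2 ℓ)
    -- the pinned frame transport
    (κ : geomPoints ((cubeSumCurve 9).baseChange K) ≃+
      geomPoints ((⟨0, 0, 1, 0, -1⟩ : WeierstrassCurve ℚ).baseChange K))
    (hκG : ∀ (g : absoluteGaloisGroup K) (P : geomPoints ((cubeSumCurve 9).baseChange K)),
      κ (g • P) = g • κ P)
    (hκ : ∀ {x y : AlgebraicClosure K}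
      (h : (((cubeSumCurve 9).baseChange K).baseChange (AlgebraicClosure K)).toAffine.Nonsingular x y),
      ∃ h', κ (.some x y h) = .some (x / 36) ((y - 108) / 216) h')
    -- the coupled frame (#R-g `exists_coupledFrame`)
    {vB vA : AlgebraicClosure K} (hvBc : vB ^ 3 = algebraMap ℚ (AlgebraicClosure K) ((p : ℚ) / 9))
    (hvB : vB ≠ 0)
    (hvAc : vA ^ 3 = algebraMap ℚ (AlgebraicClosure K) ((p : ℚ) ^ 2 / 3)) (hvA0 : vA ≠ 0)
    (hvB3 : ∀ g : absoluteGaloisGroup K,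
      ((show AlgebraicClosure K ≃ₐ[K] AlgebraicClosure K from g) vB) ^ 3 = vB ^ 3)
    (hvA3 : ∀ g : absoluteGaloisGroup K,
      ((show AlgebraicClosure K ≃ₐ[K] AlgebraicClosure K from g) vA) ^ 3 = vA ^ 3)
    {ψB : geomPoints ((cubeSumCurve 9).baseChange K) ≃+ geomPoints ((cubeSumCurve (p : ℚ)).baseChange K)}
    {ψA : geomPoints ((cubeSumCurve 9).baseChange K) ≃+
      geomPoints ((cubeSumCurve (3 * (p : ℚ) ^ 2)).baseChange K)}
    (hψB : ∀ {x y : AlgebraicClosure K}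
      (h : (((cubeSumCurve 9).baseChange K).baseChange (AlgebraicClosure K)).toAffine.Nonsingular x y),
      ∃ h', ψB (Affine.Point.some x y h) = Affine.Point.some (vB ^ 2 * x) (vB ^ 3 * y) h')
    (hψA : ∀ {x y : AlgebraicClosure K}
      (h : (((cubeSumCurve 9).baseChange K).baseChange (AlgebraicClosure K)).toAffine.Nonsingular x y),
      ∃ h', ψA (Affine.Point.some x y h) = Affine.Point.some (vA ^ 2 * x) (vA ^ 3 * y) h')
    {ρ : absoluteGaloisGroup K →
      geomPoints ((cubeSumCurve 9).baseChange K) ≃+ geomPoints ((cubeSumCurve 9).baseChange K)}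
    (hρ : ∀ (g : absoluteGaloisGroup K) {x y : AlgebraicClosure K}
        (h : (((cubeSumCurve 9).baseChange K).baseChange (AlgebraicClosure K)).toAffine.Nonsingular x y),
        ∃ h', ρ g (Affine.Point.some x y h) =
          Affine.Point.some (((show AlgebraicClosure K ≃ₐ[K] AlgebraicClosure K from g) vB / vB) ^ 2 * x)
            y h')
    (hρρ : ∀ (g : absoluteGaloisGroup K) {x y : AlgebraicClosure K}
        (h : (((cubeSumCurve 9).baseChange K).baseChange (AlgebraicClosure K)).toAffine.Nonsingular x y),
        ∃ h', ρ g (ρ g (Affine.Point.some x y h)) =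
          Affine.Point.some (((show AlgebraicClosure K ≃ₐ[K] AlgebraicClosure K from g) vA / vA) ^ 2 * x)
            y h')
    (hlawB : ∀ (g : absoluteGaloisGroup K) (P : geomPoints ((cubeSumCurve 9).baseChange K)),
        g • ψB P = ψB (ρ g (g • P)))
    (hlawA : ∀ (g : absoluteGaloisGroup K) (P : geomPoints ((cubeSumCurve 9).baseChange K)),
        g • ψA P = ψA (ρ g (ρ g (g • P))))
    (hρcomm : ∀ (g h : absoluteGaloisGroup K) (P : geomPoints ((cubeSumCurve 9).baseChange K)),
        h • ρ g P = ρ g (h • P))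
    -- the coherent embeddings `emb₀ : K[9p] → K̄`, `emb : K[9pℓ] → K̄` and their point maps
    (hle : ringClassField K ι (9 * p) ≤ ringClassField K ι (9 * p * ℓ))
    (emb₀ : ringClassField K ι (9 * p) →+* AlgebraicClosure K)
    (hemb₀ : ∀ k : K, emb₀ (algebraMap K (ringClassField K ι (9 * p)) k) = algebraMap K (AlgebraicClosure K) k)
    (emb : ringClassField K ι (9 * p * ℓ) →+* AlgebraicClosure K)
    (hemb : ∀ k : K, emb (algebraMap K (ringClassField K ι (9 * p * ℓ)) k) =
      algebraMap K (AlgebraicClosure K) k)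
    (hcoh : ∀ x : ringClassField K ι (9 * p), emb (RingClassField.inclusion ι hle x) = emb₀ x)
    (ιpt : letI : DecidableEq (ringClassField K ι (9 * p)) := fun a b ↦ Classical.propDecidable (a = b)
      ((⟨0, 0, 1, 0, -1⟩ : WeierstrassCurve ℚ).baseChange (ringClassField K ι (9 * p))).toAffine.Point →+
        geomPoints (((⟨0, 0, 1, 0, -1⟩ : WeierstrassCurve ℚ)).baseChange K))
    (hιpt : ∀ Q, ιpt Q = Affine.Point.map (W' := (⟨0, 0, 1, 0, -1⟩ : WeierstrassCurve ℚ)) emb₀.toRatAlgHom Q)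
    (ιe : letI : DecidableEq (ringClassField K ι (9 * p * ℓ)) := fun a b ↦ Classical.propDecidable (a = b)
      ((⟨0, 0, 1, 0, -1⟩ : WeierstrassCurve ℚ).baseChange (ringClassField K ι (9 * p * ℓ))).toAffine.Point →+
        geomPoints ((⟨0, 0, 1, 0, -1⟩ : WeierstrassCurve ℚ).baseChange K))
    (hιe : ∀ P, ιe P = Affine.Point.map (W' := (⟨0, 0, 1, 0, -1⟩ : WeierstrassCurve ℚ)) emb.toRatAlgHom P)
    -- the fixers `N₀ = Gal(K̄/emb₀ K[9p])`, `N = Gal(K̄/emb K[9pℓ])`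
    (N₀ : Subgroup (absoluteGaloisGroup K))
    (hN₀ : ∀ g : absoluteGaloisGroup K, g ∈ N₀ ↔
      ∀ x : ringClassField K ι (9 * p), (show AlgebraicClosure K ≃ₐ[K] AlgebraicClosure K from g) (emb₀ x) = emb₀ x)
    (N : Subgroup (absoluteGaloisGroup K))
    (hN : ∀ g : absoluteGaloisGroup K, g ∈ N ↔
      ∀ x : ringClassField K ι (9 * p * ℓ),
        (show AlgebraicClosure K ≃ₐ[K] AlgebraicClosure K from g) (emb x) = emb x)
    -- `∛3, ∛p ∈ K[9p]`, their stabiliser `H`, lifts `T`, the product representatives `t` (#H-a)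
    {c₃ cp : ringClassField K ι (9 * p)} (hc₃ : c₃ ^ 3 = 3) (hcp : cp ^ 3 = (p : ringClassField K ι (9 * p)))
    (H : Subgroup (ringClassField K ι (9 * p) ≃ₐ[K] ringClassField K ι (9 * p)))
    (hH : ∀ σ, σ ∈ H ↔ σ c₃ = c₃ ∧ σ cp = cp)
    [Fintype ((ringClassField K ι (9 * p) ≃ₐ[K] ringClassField K ι (9 * p)) ⧸ H)] [Fintype H]
    (T : (ringClassField K ι (9 * p) ≃ₐ[K] ringClassField K ι (9 * p)) → absoluteGaloisGroup K)
    (hT : ∀ σ (x : ringClassField K ι (9 * p)),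
      (show AlgebraicClosure K ≃ₐ[K] AlgebraicClosure K from T σ) (emb₀ x) = emb₀ (σ x))
    (t : ((ringClassField K ι (9 * p) ≃ₐ[K] ringClassField K ι (9 * p)) ⧸ H) × H → absoluteGaloisGroup K)
    (ht' : ∀ q h, t (q, h) = T (Quotient.out q) * T (h : _))
    (ht : Function.Bijective fun i ↦ (t i : absoluteGaloisGroup K ⧸ N₀))
    -- the involution datum at the bottom (TOWER FIXING at `n = 1`; displayed): `s ∈ H`, `s² = 1`, a half `H′`
    (s : H) (hs2 : s * s = 1) (H' : Finset H) (hH' : ∀ h : H, Xor (h ∈ H') (h * s ∈ H'))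
    -- the generator `σ_ℓ` and the CM points `y_ℓ ∈ W₀(K[9pℓ])`, `y₁ ∈ W₀(K[9p])`
    {σ : ringClassField K ι (9 * p * ℓ) ≃ₐ[ℚ] ringClassField K ι (9 * p * ℓ)}
    (hσ : Subgroup.zpowers σ = ringClassGalOver ι (9 * p * ℓ) (9 * p))
    {y : ((⟨0, 0, 1, 0, -1⟩ : WeierstrassCurve ℚ).baseChange (ringClassField K ι (9 * p * ℓ))).toAffine.Point}
    (hy : Affine.Point.map (W' := (⟨0, 0, 1, 0, -1⟩ : WeierstrassCurve ℚ))
        (ringClassField K ι (9 * p * ℓ)).subtype.toRatAlgHom y =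
      Dt.φ (heegnerTau ((ℓ : ℤ) ^ 2 * (81 * ((p : ℤ) ^ 2 + 4 * p + 16)),
        (ℓ : ℤ) * (-(9 * (4 * (p : ℤ) ^ 2 + 17 * p + 72))), 4 * (p : ℤ) ^ 2 + 18 * p + 81)))
    {y₁ : ((⟨0, 0, 1, 0, -1⟩ : WeierstrassCurve ℚ).baseChange (ringClassField K ι (9 * p))).toAffine.Point}
    (hy₁ : Affine.Point.map (W' := (⟨0, 0, 1, 0, -1⟩ : WeierstrassCurve ℚ))
        (ringClassField K ι (9 * p)).subtype.toRatAlgHom y₁ =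
      Dt.φ (heegnerTau (81 * ((p : ℤ) ^ 2 + 4 * p + 16), -(9 * (4 * (p : ℤ) ^ 2 + 17 * p + 72)),
        4 * (p : ℤ) ^ 2 + 18 * p + 81)))
    (hsy : pointGalHom (⟨0, 0, 1, 0, -1⟩ : WeierstrassCurve ℚ) (ringClassField K ι (9 * p))
      ((s : _ ≃ₐ[K] _).restrictScalars ℚ) y₁ = y₁)
    -- THE TOWER FIXING at `n = ℓ` (W2-b; displayed, not proved): a lift `φ` of `s` to `K[9pℓ]` fixing `y_ℓ`
    (φ : ringClassField K ι (9 * p * ℓ) ≃ₐ[K] ringClassField K ι (9 * p * ℓ))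
    (hφs : ∀ x : ringClassField K ι (9 * p),
      φ (RingClassField.inclusion ι hle x) =
        RingClassField.inclusion ι hle ((s : ringClassField K ι (9 * p) ≃ₐ[K] ringClassField K ι (9 * p)) x))
    (hφy : pointGalHom (⟨0, 0, 1, 0, -1⟩ : WeierstrassCurve ℚ) (ringClassField K ι (9 * p * ℓ))
      (φ.restrictScalars ℚ) y = y)
    -- #19's transport equation for HSY's `Y₁ ∈ E_p(K)`, and the HALF point `Y′` (#S1): `2 • Y′ = Y₁`
    (T₃ : ((⟨0, 0, 1, 0, -1⟩ : WeierstrassCurve ℚ).baseChange (ringClassField K ι (9 * p))).toAffine.Point)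
    (hT₃ : 3 • T₃ = 0) (Y₁ : ((cubeSumCurve (p : ℚ)).baseChange K).toAffine.Point)
    (hY₁ : toGeomPoints ((cubeSumCurve (p : ℚ)).baseChange K) Y₁ =
      ψB (κ.symm (ιpt ((∑ h : H, pointGalHom (⟨0, 0, 1, 0, -1⟩ : WeierstrassCurve ℚ)
        (ringClassField K ι (9 * p)) ((h : _ ≃ₐ[K] _).restrictScalars ℚ) y₁) - T₃))))
    (Y' : ((cubeSumCurve (p : ℚ)).baseChange K).toAffine.Point) (h2Y' : (2 : ℕ) • Y' = Y₁)
    (hdivA : ∀ P : geomPoints ((cubeSumCurve (3 * (p : ℚ) ^ 2)).baseChange K),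
      ∃ R : geomPoints ((cubeSumCurve (3 * (p : ℚ) ^ 2)).baseChange K), ((2 : ℕ) : ℤ) • R = P)
    (hdivB : ∀ P : geomPoints ((cubeSumCurve (p : ℚ)).baseChange K),
      ∃ R : geomPoints ((cubeSumCurve (p : ℚ)).baseChange K), ((2 : ℕ) : ℤ) • R = P) :
    ∃ (hA₁ : IsAdmissible (absoluteGaloisGroup K)
        ((FixedPoints.addSubgroup N (geomPoints ((cubeSumCurve 9).baseChange K))).map ψA.toAddMonoidHom)
        ((2 : ℕ) : ℤ))
      (_ : (∑ i : ((ringClassField K ι (9 * p) ≃ₐ[K] ringClassField K ι (9 * p)) ⧸ H) × H',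
          ρ (t (i.1, (i.2 : H))) (ρ (t (i.1, (i.2 : H))) (t (i.1, (i.2 : H)) •
          κ.symm (ιe (KolyvaginOperator.derivOp
            (pointGalHom (⟨0, 0, 1, 0, -1⟩ : WeierstrassCurve ℚ) (ringClassField K ι (9 * p * ℓ))) σ ℓ y))))) ∈
        FixedPoints.addSubgroup N (geomPoints ((cubeSumCurve 9).baseChange K)))
      (hP₁ : ψA (∑ i : ((ringClassField K ι (9 * p) ≃ₐ[K] ringClassField K ι (9 * p)) ⧸ H) × H',
          ρ (t (i.1, (i.2 : H))) (ρ (t (i.1, (i.2 : H))) (t (i.1, (i.2 : H)) •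
          κ.symm (ιe (KolyvaginOperator.derivOp
            (pointGalHom (⟨0, 0, 1, 0, -1⟩ : WeierstrassCurve ℚ) (ringClassField K ι (9 * p * ℓ))) σ ℓ y))))) ∈
        invPoints (absoluteGaloisGroup K)
          ((FixedPoints.addSubgroup N (geomPoints ((cubeSumCurve 9).baseChange K))).map ψA.toAddMonoidHom)
          ((2 : ℕ) : ℤ)),
      (∀ h ∈ N, (show AlgebraicClosure K ≃ₐ[K] AlgebraicClosure K from h) vA = vA) ∧
      ∀ (v : HeightOneSpectrum (𝓞 K)), (ℓ : 𝓞 K) ∈ v.asIdeal →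
        (kolyvaginClass ((cubeSumCurve (3 * (p : ℚ) ^ 2)).baseChange K) ((2 : ℕ) : ℤ) hdivA hA₁
            (ψA (∑ i : ((ringClassField K ι (9 * p) ≃ₐ[K] ringClassField K ι (9 * p)) ⧸ H) × H',
          ρ (t (i.1, (i.2 : H))) (ρ (t (i.1, (i.2 : H))) (t (i.1, (i.2 : H)) •
          κ.symm (ιe (KolyvaginOperator.derivOp
            (pointGalHom (⟨0, 0, 1, 0, -1⟩ : WeierstrassCurve ℚ) (ringClassField K ι (9 * p * ℓ))) σ ℓ y)))))) hP₁ ∈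
            selmerLocalKer ((cubeSumCurve (3 * (p : ℚ) ^ 2)).baseChange K) (v.adicCompletion K) ((2 : ℕ) : ℤ) ↔
          kummerClassOfPoint (cubeSumCurve (p : ℚ)) K Nat.prime_two Y' ∈
            ((cubeSumCurve (p : ℚ)).baseChange K).torsionLocalKer (v.adicCompletion K) ((2 : ℕ) : ℤ)) := by
  -- ### basics from the clause
  obtain ⟨hℓ, hℓA, hℓB, hℓdK, hℓ2, hinert, hFrobA, hFrobB⟩ := hKol
  haveI : Fact ℓ.Prime := ⟨hℓ⟩
  obtain ⟨hℓ3, hℓp⟩ := mod_three_eq_two_of_clause hω h2 hp hp3 hℓ hℓdK hFrobB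
  have hK := JZero.isImaginaryQuadratic_of_sq_add_self_add_one hω h2
  have hdK := JZero.discr_eq_neg_three_of_sq_add_self_add_one hω h2
  have hp0 : p ≠ 0 := hp.ne_zero
  have hℓ3' : ℓ ≠ 3 := by rintro rfl; norm_num at hℓ3
  have hp_odd : Odd p := hp.eq_two_or_odd'.resolve_left (by rintro rfl; norm_num at hp3)
  have hℓ_odd : Odd ℓ := hℓ.eq_two_or_odd'.resolve_left hℓ2
  haveI := isElliptic_sylvesterNineMinimal
  haveI := isGloballyMinimal_sylvesterNineMinimal
  haveI := isElliptic_cubeSumCurve_baseChange K (n := (p : ℚ)) (by exact_mod_cast hp0)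
  have hΔ := not_dvd_minimalDiscriminantInt_sylvesterNineMinimal hℓ hℓ3'
  have hn0 : 9 * p * ℓ ≠ 0 := mul_ne_zero (mul_ne_zero (by norm_num) hp0) hℓ.ne_zero
  have hm0 : 9 * p ≠ 0 := mul_ne_zero (by norm_num) hp0
  haveI := (finiteDimensional_and_isGalois_ringClassField hK ι hn0).2
  haveI := (finiteDimensional_and_isGalois_ringClassField hK ι hm0).1
  haveI hNn : N.Normal := normal_of_mem_iff emb hemb N hN
  -- ### `N₀` read at the level `9pℓ` (the binder `hN'`)
  have hN' := mem_iff_forall_mem_nine_mul ι hle emb₀ emb hcoh hN₀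
  have hNN₀ : N ≤ N₀ := le_of_mem_iff_of_mem_iff_forall emb hN hN'
  -- ### the bottom point read at the level `9pℓ`: `y₀ = incl y₁`, `ι_e y₀ = ι_pt y₁`
  set y₀ : ((⟨0, 0, 1, 0, -1⟩ : WeierstrassCurve ℚ).baseChange (ringClassField K ι (9 * p * ℓ))).toAffine.Point :=
    Affine.Point.map (W' := (⟨0, 0, 1, 0, -1⟩ : WeierstrassCurve ℚ))
      ((RingClassField.inclusion ι hle).restrictScalars ℚ) y₁ with hy₀def
  have hy₀ : Affine.Point.map (W' := (⟨0, 0, 1, 0, -1⟩ : WeierstrassCurve ℚ))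
        (ringClassField K ι (9 * p * ℓ)).subtype.toRatAlgHom y₀ =
      Dt.φ (heegnerTau (81 * ((p : ℤ) ^ 2 + 4 * p + 16), -(9 * (4 * (p : ℤ) ^ 2 + 17 * p + 72)),
        4 * (p : ℤ) ^ 2 + 18 * p + 81)) := by
    rw [← hy₁, hy₀def]
    exact RingClassTower.map_toRatAlgHom_map_inclusion (W := (⟨0, 0, 1, 0, -1⟩ : WeierstrassCurve ℚ)) ι hle
      (ringClassField K ι (9 * p * ℓ)).subtype (ringClassField K ι (9 * p)).subtype
      (fun x' ↦ RingClassField.coe_inclusion ι hle x') y₁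
  have he : ιe y₀ = ιpt y₁ := by
    rw [hιe, hιpt, hy₀def]
    exact RingClassTower.map_toRatAlgHom_map_inclusion (W := (⟨0, 0, 1, 0, -1⟩ : WeierstrassCurve ℚ)) ι hle
      emb emb₀ hcoh y₁
  -- ### admissibility of `ψ_A(E₉(K̄)^N)`, `ψ_B(E₉(K̄)^N)` (`∛6 ∉ K[9pℓ]`)
  have h6 := pow_three_ne_six_of_fix_sylvester_prime hK hdK ι hp_odd hℓ_odd emb hemb N hN
  have hρρ' : ∀ (g : absoluteGaloisGroup K) {x y : AlgebraicClosure K}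
      (h : (((cubeSumCurve 9).baseChange K).baseChange (AlgebraicClosure K)).toAffine.Nonsingular x y),
      ∃ h', (fun g ↦ (ρ g).trans (ρ g)) g (Affine.Point.some x y h) =
        Affine.Point.some (((show AlgebraicClosure K ≃ₐ[K] AlgebraicClosure K from g) vA / vA) ^ 2 * x)
          y h' := fun g x y h ↦ hρρ g h
  have hlawA' : ∀ (g : absoluteGaloisGroup K) (P : geomPoints ((cubeSumCurve 9).baseChange K)),
      g • ψA P = ψA ((fun g ↦ (ρ g).trans (ρ g)) g (g • P)) := fun g P ↦ hlawA g P
  have hA₁' := isAdmissible_map_fixedPoints_cubeSumCurve_nine K hω hvA0 hvA3 hρρ' hlawA' N h6 1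
  have hA₂' := isAdmissible_map_fixedPoints_cubeSumCurve_nine K hω hvB hvB3 hρ hlawB N h6 1
  have hA₁ : IsAdmissible (absoluteGaloisGroup K)
      ((FixedPoints.addSubgroup N (geomPoints ((cubeSumCurve 9).baseChange K))).map ψA.toAddMonoidHom)
      ((2 : ℕ) : ℤ) := hA₁'
  have hA₂ : IsAdmissible (absoluteGaloisGroup K)
      ((FixedPoints.addSubgroup N (geomPoints ((cubeSumCurve 9).baseChange K))).map ψB.toAddMonoidHom)
      ((2 : ℕ) : ℤ) := hA₂'
  -- ### the HALF level package (#S4): `hQN`, `hP₁`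
  obtain ⟨hQN, hP₁⟩ := half_chiComponentA_mem_invPoints hω h2 ι Dt hp hp3
    ⟨hℓ, hℓA, hℓB, hℓdK, hℓ2, hinert, hFrobA, hFrobB⟩ κ hκG hvBc hvB hvAc hvA0 hvB3 hvA3 hρ hρρ hlawA hle emb₀
    hemb₀ emb hemb hcoh ιe hιe N₀ hN₀ N hN hc₃ hcp H hH T hT t ht' s hs2 H' hH' hσ hy hy₁ φ hφs hφy
  -- ### the HALF bottom: `ψ_B(half sum of y₀-conjugates) = ι([𝒢₀:H] • Y′ + T₀′)` (#S2), fixed by `Γ_K`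
  obtain ⟨T₀, hT₀, hbot⟩ := half_bottom_chiComponent_eq_toGeomPoints hω h2 ι hp0 hp_odd κ hκG hvBc hvB hvB3 hψB
    hρ hlawB hρcomm emb₀ hemb₀ ιpt hιpt N₀ hN₀ hc₃ hcp H hH T hT t ht' ht s H' hH' y₁ T₃ hsy hT₃ Y₁ Y' hY₁ h2Y'
  have hQe : ψB (∑ i : ((ringClassField K ι (9 * p) ≃ₐ[K] ringClassField K ι (9 * p)) ⧸ H) × H',
        ρ (t (i.1, (i.2 : H))) (t (i.1, (i.2 : H)) • κ.symm (ιe y₀))) =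
      toGeomPoints ((cubeSumCurve (p : ℚ)).baseChange K)
        ((Fintype.card ((ringClassField K ι (9 * p) ≃ₐ[K] ringClassField K ι (9 * p)) ⧸ H) : ℤ) • Y' + T₀) := by
    rw [he]; exact hbot
  have hNvB : ∀ n ∈ N, (show AlgebraicClosure K ≃ₐ[K] AlgebraicClosure K from n) vB = vB := fun n hn ↦
    apply_vB_eq_of_mem_fixer hω ι hp0 hvBc emb₀ N₀ hN₀ hc₃ hcp n (hNN₀ hn)
  have hP₂ : ψB (∑ i : ((ringClassField K ι (9 * p) ≃ₐ[K] ringClassField K ι (9 * p)) ⧸ H) × H',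
        ρ (t (i.1, (i.2 : H))) (t (i.1, (i.2 : H)) • κ.symm (ιe y₀))) ∈
      invPoints (absoluteGaloisGroup K)
        ((FixedPoints.addSubgroup N (geomPoints ((cubeSumCurve 9).baseChange K))).map ψB.toAddMonoidHom)
        ((2 : ℕ) : ℤ) := by
    rw [hQe]
    exact mem_invPoints_of_fixed (toGeomPoints_mem_map_fixedPoints hψB N hNvB _) fun g ↦ smul_toGeomPoints _ g _
  -- ### its class is `δ Y′` (#G), hence Selmer at every place
  have hodd : Odd ((Fintype.card ((ringClassField K ι (9 * p) ≃ₐ[K] ringClassField K ι (9 * p)) ⧸ H) : ℕ) : ℤ) := by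
    have h := odd_card_quotient_stabilizer hω hc₃ hp0 hcp H hH
    rw [Nat.card_eq_fintype_card] at h
    exact_mod_cast h
  have hcls := kolyvaginClass_eq_kummerClassOfPoint_of_eq (cubeSumCurve (p : ℚ)) (hdiv := hdivB) hA₂ Y' T₀ hT₀
    hodd hQe hP₂
  -- ### the general-shape reading of the pinned `κ` (#F1's `hκ`)
  have hκ' : ∀ {x y : AlgebraicClosure K}
      (h : (((cubeSumCurve 9).baseChange K).baseChange (AlgebraicClosure K)).toAffine.Nonsingular x y),
      ∃ h', κ (.some x y h) = .some ((36 : AlgebraicClosure K)⁻¹ * x)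
        ((216 : AlgebraicClosure K)⁻¹ * y + -(1 / 2)) h' := by
    intro x y h
    obtain ⟨h', e⟩ := hκ h
    have ex : x / 36 = (36 : AlgebraicClosure K)⁻¹ * x := by ring
    have ey : (y - 108) / 216 = (216 : AlgebraicClosure K)⁻¹ * y + -(1 / 2) := by ring
    exact ⟨ex ▸ ey ▸ h', e.trans (Affine.Point.some_eq_some_of_eq ex ey)⟩
  -- ### (ES2) from the named fact (#20), read through `ι_e`
  have hES : ∀ (φ₀ : absoluteGaloisGroup (ZMod ℓ)), (∀ x : AlgebraicClosure (ZMod ℓ), φ₀ • x = x ^ ℓ) →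
      ∀ g : absoluteGaloisGroup K,
        geomReduction hΔ ((RatClosure.pointsEquiv (K := K) (⟨0, 0, 1, 0, -1⟩ : WeierstrassCurve ℚ)).symm
            (g • ιe y)) =
          φ₀ • geomReduction hΔ ((RatClosure.pointsEquiv (K := K)
            (⟨0, 0, 1, 0, -1⟩ : WeierstrassCurve ℚ)).symm (g • ιe y₀)) := by
    intro φ₀ hφ₀ g
    rw [hιe, hιe]
    exact geomReduction_sylvester_prime_eq_frob_smul hES2 hK hdK ι Dt hp3 hℓ2 hℓ3 hℓp hinert hy hy₀
      (Affine.Point.map (W' := (⟨0, 0, 1, 0, -1⟩ : WeierstrassCurve ℚ)) emb.toRatAlgHom) emb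
      (fun hab ↦ ⟨_, rfl⟩) hΔ hφ₀ g
  -- ### THE FLIP for the half index set (#S5), `hsel₂` = the Kummer class `δ Y′` is Selmer everywhere
  refine ⟨hA₁, hQN, hP₁, fun h hh ↦ ?_, fun v hv ↦ ?_⟩
  · exact (forall_apply_eq_of_pow_three_eq_sq_div_three_of_fix_nine_mul hω h2 ι hp0 hℓ.ne_zero emb hemb N₀ hN')
      h (hNN₀ hh) vA hvAc
  have hsel₂ : kolyvaginClass ((cubeSumCurve (p : ℚ)).baseChange K) ((2 : ℕ) : ℤ) hdivB hA₂
      (ψB (∑ i : ((ringClassField K ι (9 * p) ≃ₐ[K] ringClassField K ι (9 * p)) ⧸ H) × H',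
        ρ (t (i.1, (i.2 : H))) (t (i.1, (i.2 : H)) • κ.symm (ιe y₀)))) hP₂ ∈
      selmerLocalKer ((cubeSumCurve (p : ℚ)).baseChange K) (v.adicCompletion K) ((2 : ℕ) : ℤ) := by
    rw [hcls]
    exact kummerMapTorsion_mem_selmerLocalKer _ _ _ _ Y'
  have hflip := flip_levelPrime_of_bottomSelmer hω h2 ι Dt hp hp3 hℓ3 hℓ2 hℓp hℓA hℓB hℓdK hFrobB hΔ κ hκG hκ'
    hvBc hvB hvAc hvA0 hvB3 hvA3 hψB hψA hρ hρρ hlawB hlawA hρcomm emb hemb ιe hιe N hN N₀ hN'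
    (fun i : ((ringClassField K ι (9 * p) ≃ₐ[K] ringClassField K ι (9 * p)) ⧸ H) × H' ↦ t (i.1, (i.2 : H)))
    hσ hy hy₀ (hdivA := hdivA) (hdivB := hdivB) hA₁ hA₂ hP₁ hP₂ hES v hv hsel₂
  rwa [hcls] at hflip

end Summit.BirchSwinnertonDyer.BirchSwinnertonDyer.Theorems.SylvesterTwoCMHalf

end
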